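import Mathlib
import HarnessLib
import Summits.CriticalPhenomena.CardyFormulaZ2.Theses.CardyMagicRigidity
import Summits.CriticalPhenomena.CardyFormulaZ2.Theorems.CardyMagicRigidityMagicFormulaTCoefficientResidue
import Summits.CriticalPhenomena.CardyFormulaZ2.Theorems.CardyMagicRigidityMagicFormulaTThirdOrderReduction
import Summits.CriticalPhenomena.CardyFormulaZ2.Theorems.CardyMagicRigidityMagicFormulaTThreePointExistsLimit
import Literature.Probability.RandomPlanarGeometry.NestingTransform

/-!
# Line `Sketch` for crux `MagicFormulaT`, sub-goal `threePoint_of_magicFormulaT`: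
# the crux forces the three-point power-sum expectation to vanish in the limit

Crux `Summit.CriticalPhenomena.CardyFormulaZ2.Theses.CardyMagicRigidity.MagicFormulaT`
(stmt-CriticalPhenomena-4836), line `Sketch`, sub-goal of lead c5 (necessity of the order-3 condition).

For an admissible density `f` (`|f| ≤ C`, `f = 0` off `B̄(0, R)`, `∫ f = 0`) put `θ_u = u.nestingPhase f`,
`A_m = Σ_u θ_u^m` (loops `u` of `siteLoopConfig δ ω`), `Φ_δ(t) = E_{1/2}[∏_u 2cos(t θ_u + π/3)]` (`t ∈ ℂ`)
and `G_f(t) = exp(q(f) t²)`, `q(f) = (3/4π²) ∬ log‖x − y‖ f(x) f(y)`.  **Claim.**  If the crux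
`MagicFormulaT` holds, then `E_{1/2}[3A₁³ − 12A₁A₂ + 8A₃] → 0` as the mesh `δ ↓ 0`.

Proof.  The crux identifies every Taylor coefficient of `Φ_δ` at `0` with that of `G_f` in the limit
(`cfi_coefficients_of_magicFormulaT`); at order `k = 3` the Gaussian side vanishes by evenness
(`ho_iteratedDeriv_three_cexp_sq`), so `Φ_δ'''(0) → 0` in `ℂ` along `𝓝[>] 0`.  At every positive mesh
`Φ_δ'''(0) = ↑(−√3 · E_{1/2}[3A₁³ − 12A₁A₂ + 8A₃])` (`ho_iteratedDeriv_three_eq`), hence eventually along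
`𝓝[>] 0`; taking real parts and dividing by `−√3 ≠ 0` (`tel_tendsto_of_ofReal_const_mul`) gives
`E_δ[…] → (0 : ℂ).re / (−√3) = 0`.
The crux enters only as a hypothesis; no named fact is used; no definition is introduced.
-/

noncomputable section

namespace Summit.CriticalPhenomena.CardyFormulaZ2.Cruxes.MagicFormulaT.LineSketch

open MeasureTheory Filter Set
open scoped Real Topology BigOperators ENNReal
open Literature.Probability.RandomPlanarGeometry Literature.Probability.Percolation
  Literature.Probability.LatticeModels

/-- **Sub-goal `threePoint_of_magicFormulaT` · the crux forces the three-point power-sum limit to vanish.**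
If `MagicFormulaT` holds then, for every admissible `f`, `E_{1/2}[3A₁³ − 12A₁A₂ + 8A₃] → 0` as `δ ↓ 0`
(`A_m = Σ_u θ_u(f)^m` over the loops of `siteLoopConfig δ ω`): the third Taylor coefficient `Φ_δ'''(0)` of
the complex-coupling nesting transform tends to `G_f'''(0)` (`cfi_coefficients_of_magicFormulaT`, `k = 3`),
which is `0` (`ho_iteratedDeriv_three_cexp_sq`); it equals `↑(−√3 · E_δ[…])` at every positive mesh
(`ho_iteratedDeriv_three_eq`), and real parts divided by `−√3` conclude
(`tel_tendsto_of_ofReal_const_mul`). -/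
theorem threePoint_of_magicFormulaT :
    Summit.CriticalPhenomena.CardyFormulaZ2.Theses.CardyMagicRigidity.MagicFormulaT →
    ∀ (f : ℂ → ℝ) (R C : ℝ), Measurable f → (∀ z, |f z| ≤ C) → (∀ z, R < ‖z‖ → f z = 0) → ∫ z, f z = 0 →
    Tendsto (fun δ : ℝ ↦ ∫ ω, (3 * (∑ᶠ u ∈ (siteLoopConfig δ ω).loops, u.nestingPhase f) ^ 3 -
      12 * (∑ᶠ u ∈ (siteLoopConfig δ ω).loops, u.nestingPhase f) *
        (∑ᶠ u ∈ (siteLoopConfig δ ω).loops, u.nestingPhase f ^ 2) +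
      8 * (∑ᶠ u ∈ (siteLoopConfig δ ω).loops, u.nestingPhase f ^ 3)) ∂(triSitePercolation half))
      (𝓝[>] (0 : ℝ)) (𝓝 0) := by
  intro hM f R C hf hC hR h0
  -- the third Taylor coefficient tends to `G_f'''(0) = 0`
  have ha := cfi_coefficients_of_magicFormulaT hM hf hC hR h0 3
  rw [ho_iteratedDeriv_three_cexp_sq] at ha
  -- at every positive mesh it is `↑(−√3 · E_δ[3A₁³ − 12A₁A₂ + 8A₃])`; take real parts and divide
  have hsqrt : (-Real.sqrt 3 : ℝ) ≠ 0 :=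
    neg_ne_zero.2 (Real.sqrt_ne_zero'.2 (by norm_num))
  have key := tel_tendsto_of_ofReal_const_mul hsqrt ha
    (eventually_nhdsWithin_of_forall fun δ hδ ↦ (ho_iteratedDeriv_three_eq hf hC hR h0 hδ).symm)
  rwa [Complex.zero_re, zero_div] at key

end Summit.CriticalPhenomena.CardyFormulaZ2.Cruxes.MagicFormulaT.LineSketch

end
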